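import Summits.FinalStateConjecture.FinalStateConjecture.Statement
import Literature.Geometry.Lorentzian.FinalState
import Literature.Geometry.Lorentzian.Genericity
import Literature.Geometry.Lorentzian.MinkowskiCauchyDevelopment
import Literature.Geometry.Lorentzian.CauchyProblemProofs
import Literature.Geometry.Lorentzian.LeviCivitaProofs
import Literature.Geometry.Lorentzian.GeodesicProofs

/-!
# `WeakCosmicCensorshipMGHD` (crux `stmt-FinalStateConjecture-9952`): the `[T2Space Σ]` hypothesis
# is load-bearing (degenerately), and Minkowski passes the sojourn test over the repaired carrier

Support file of the crux disprover (cdisprove seat), `sorry`-free: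

* `t2Space_of_dataEmbedding`, `isEmpty_vacuumCauchyDevelopment_of_not_t2Space` — a data embedding
  into a (Hausdorff) spacetime forces the data manifold to be Hausdorff, so data on a non-Hausdorff
  `Σ` have no vacuum Cauchy development at all; `wccWithoutT2_false_of` — the crux with `[T2Space Σ]`
  deleted (written out in the conclusion) is false as soon as one
  non-Hausdorff connected second-countable `3`-manifold carries an admissible datum.
* `minkowski_hasCompleteNullInfinity` — `Minkowski.vacuumCauchyDevelopment` has complete future null
  infinity in the sojourn sense (`Summit.FinalStateConjecture.HasCompleteNullInfinity`): the test
  table entry "Minkowski ✓" of `NullInfinity.lean`, for the first time over the repaired structure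
  `VacuumCauchyDevelopment` (the tree's `minkowski_hasCompleteFutureNullInfinity` is stated over the
  defective `Minkowski.development` under the inconsistent class `Minkowski.DevelopmentFacts`).
-/

noncomputable section

open Bundle TopologicalSpace Manifold Set Function
open scoped ContDiff Topology

namespace Summit.FinalStateConjecture.FinalStateConjecture.Theorems.WeakCosmicCensorshipMGHD.Negative

open Literature.Geometry.Lorentzian

/-! ## The Hausdorff hypothesis on `Σ` -/

section T2

variable {X : Type} [TopologicalSpace X] [ChartedSpace E3 X]
  [IsManifold (modelWithCornersSelf ℝ E3) ((⊤ : ℕ∞) : WithTop ℕ∞) X] [ConnectedSpace X]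

/-- **A data embedding forces the data manifold to be Hausdorff**: `ι : Σ → M` is a topological
embedding into the carrier of a `Spacetime`, which is T2 by definition of `LorentzianManifold`. -/
theorem t2Space_of_dataEmbedding {D : InitialDataSet (modelWithCornersSelf ℝ E3) X}
    (𝒮 : DataEmbedding D) : T2Space X :=
  𝒮.isSmoothEmbedding.isEmbedding.t2Space

/-- **On a non-Hausdorff `Σ` no datum has a vacuum Cauchy development** (no data embedding into a
Hausdorff spacetime), let alone a maximal one: every datum is exceptional for the censored
property. -/
theorem isEmpty_vacuumCauchyDevelopment_of_not_t2Space (hX : ¬ T2Space X)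
    (D : InitialDataSet (modelWithCornersSelf ℝ E3) X) : IsEmpty (VacuumCauchyDevelopment D) :=
  ⟨fun 𝒟 ↦ hX (t2Space_of_dataEmbedding 𝒟.toDataEmbedding)⟩

end T2

/-- **The T2-free crux is false as soon as one non-Hausdorff connected second-countable
`3`-manifold carries an admissible datum**: the statement in the conclusion is the crux with
`[T2Space Σ]` deleted (everything else verbatim, the censored property written out); under the
hypothesis `H` its `Y`-instance fails, because every datum on `Y` is exceptional
(`isEmpty_vacuumCauchyDevelopment_of_not_t2Space`), so the curve through an admissible one cannot
escape. `H` is constructible in principle — `ℝ³` with a doubled origin (the `3`-dimensional analogue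
of `TwoOriginLine`) with the flat data pulled back along the projection is complete, flat, and has
one AF end with compact complement — but is not constructed here; so `[T2Space Σ]` is load-bearing
only for this degenerate reason. -/
theorem wccWithoutT2_false_of
    (H : ∃ (Y : Type) (_ : TopologicalSpace Y) (_ : ChartedSpace E3 Y)
      (_ : IsManifold (modelWithCornersSelf ℝ E3) ((⊤ : ℕ∞) : WithTop ℕ∞) Y)
      (_ : SecondCountableTopology Y) (_ : ConnectedSpace Y),
      ¬ T2Space Y ∧ (admissibleVacuumData Y).Nonempty) :
    ¬ ∀ (X : Type) [TopologicalSpace X] [ChartedSpace E3 X]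
      [IsManifold (modelWithCornersSelf ℝ E3) ((⊤ : ℕ∞) : WithTop ℕ∞) X]
      [SecondCountableTopology X] [ConnectedSpace X],
      InitialDataSet.IsChristodoulouGeneric (admissibleVacuumData X)
        (fun D ↦ (∃ 𝒟 : VacuumCauchyDevelopment D, 𝒟.IsMaximal) ∧
          ∀ 𝒟 : VacuumCauchyDevelopment D, 𝒟.IsMaximal →
            _root_.Summit.FinalStateConjecture.HasCompleteNullInfinity 𝒟.toCauchyDevelopment) 1 := by
  rintro hW
  obtain ⟨Y, _, _, _, _, _, hY, ⟨D, hD⟩⟩ := H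
  have hbad : ∀ D' : InitialDataSet (modelWithCornersSelf ℝ E3) Y,
      ¬ ((∃ 𝒟 : VacuumCauchyDevelopment D', 𝒟.IsMaximal) ∧
        ∀ 𝒟 : VacuumCauchyDevelopment D', 𝒟.IsMaximal →
          _root_.Summit.FinalStateConjecture.HasCompleteNullInfinity 𝒟.toCauchyDevelopment) :=
    fun D' h ↦ (isEmpty_vacuumCauchyDevelopment_of_not_t2Space hY D').false h.1.choose
  obtain ⟨F, -, -, -, hadm, hexc⟩ := hW Y D ⟨hD, hbad D⟩
  have hc : (EuclideanSpace.single (0 : Fin 1) (1 : ℝ) : EuclideanSpace ℝ (Fin 1)) ≠ 0 := fun h0 ↦ by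
    simpa using congrArg (fun c : EuclideanSpace ℝ (Fin 1) ↦ c 0) h0
  exact hexc _ hc ⟨hadm _, hbad _⟩

/-! ## Minkowski passes the sojourn test over the repaired structure -/

/-- **Minkowski spacetime, as the vacuum Cauchy development `Minkowski.vacuumCauchyDevelopment` of
the trivial data `(ℝ³, δ, 0)`, has complete future null infinity in the sojourn sense.** Every
normalised null ray is a maximal geodesic of `η`; `η` is geodesically complete
(`Minkowski.isGeodesicallyComplete_smoothMetric`: straight lines), so by uniqueness of geodesics
(`IsGeodesicOn.eqOn_of_velocity_eq_holds`, the Levi-Civita connection being `C¹`,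
`isLocallyContMDiff_leviCivita_holds`) its affine domain is all of `ℝ`, unbounded above: the first
disjunct of the sojourn alternative, with `B₀ = B₁ = ∅`
(`hasCompleteFutureNullInfinity_of_isNullGeodesicallyComplete`). This is the "Minkowski ✓" entry of
the test table of `NullInfinity.lean`, for the first time over the REPAIRED carrier (the tree's
`minkowski_hasCompleteFutureNullInfinity` is stated over the defective `Minkowski.development` under
the inconsistent class `Minkowski.DevelopmentFacts`). [cite: Christodoulou1999, p. A27] -/
theorem minkowski_hasCompleteNullInfinity :
    _root_.Summit.FinalStateConjecture.HasCompleteNullInfinity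
      Minkowski.vacuumCauchyDevelopment.toCauchyDevelopment := by
  intro _inst
  haveI : Minkowski.smoothMetric.toPseudoRiemannianMetric.HasLeviCivita := _inst
  haveI : CovariantDerivative.ContMDiffCovariantDerivative
      Minkowski.vacuumCauchyDevelopment.metric.toPseudoRiemannianMetric.leviCivita 1 :=
    ⟨Minkowski.vacuumCauchyDevelopment.metric.toPseudoRiemannianMetric.isLocallyContMDiff_leviCivita_holds
      1 (by rw [show ((1 : ℕ∞) : ℕ∞ω) + 1 = 2 by norm_num]; exact WithTop.coe_le_coe.2 le_top)
      univ isOpen_univ⟩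
  refine LorentzianMetric.hasCompleteFutureNullInfinity_of_isNullGeodesicallyComplete
    IsGeodesicOn.eqOn_of_velocity_eq_holds (fun x v _ ↦ ?_) _
  exact Minkowski.isGeodesicallyComplete_smoothMetric x v

end Summit.FinalStateConjecture.FinalStateConjecture.Theorems.WeakCosmicCensorshipMGHD.Negative

end
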